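import Summits.ResolutionOfSingularities.ResolutionOfSingularities.Theorems.MarkedTransferCampaignW12K12Box
import Literature.AlgebraicGeometry.Hironaka2017.NegaWitness
import Mathlib.Tactic
import HarnessLib

/-!
# [OURS · L1 W1.2 · kill test K1.2] The R08 witness `(y² + xw², 2)` and the second R05 witness under the
# Frobenius-sandwich negative modules: unit-free in every degree

Companion of `MarkedTransferCampaignW12K12Box.lean` (same slot, seat, preregistration and honest framing; read
its header first). Here: the ALIVE-type rows of K1.2.

* Part D — W1 = `E₁ = (y² + x w², 2) ⊂ A³_{𝔽₂}` at `0` (the prior record's R01/R04/R08 witness, tree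
  `NegaWitness`: absolute `℘nega(E₁,−a) ∋ ∂_y^{(2)} g₁ = 1` for every `a`). Kernel: the schema instance
  `W1_sandwichPNega_le` / `W1_sandwichNegaNoUnit` (sandwich modules `⊆ 𝔪₀` in EVERY degree, given
  `℘(E₁,2) ⊆ (x²,y²,w²)` and `℘(E₁,2d) ⊆ 𝔪₀^{2d}`), and the chart identities (C1)–(C4) certifying the
  hypothesis: each is an `E₁`-permissible blow-up (centre inside `Sing`, checked as membership of the
  controlled transform of `g₁` in the square of the centre's ideal) whose permissibility for `((f),2)`,
  `f ∈ ℘(E₁,2)` (geometric definition of `℘`, [Hironaka2017] p.17, used only as a DEFINITION), kills the box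
  coefficients: `xy, xw` (C2: the `x`-axis), `yw` (C3: point, then the `w`-chart origin), `xyw` (C4: the moving
  centre `V(x − t², y, w)` over `Z[t]`, then the `t`-axis of the `w`-chart). `W1_box_exponents` is the `decide`d
  bookkeeping. The one prose step (linear independence of `t^{2i}` in the `z'`-component, giving
  `f_{i11} = 0` for all `i` and not only `xyw ∉ ℘(E₁,2)`) is written out in KILL-TEST-K1.2.md §3.
* Part E — W3 = `E₃ = (y² + yx⁴ + yx² + x⁴, 2) ⊂ A²_{𝔽₂}` at `0` (REFEREE C5 (H) of the prior record).
  Kernel: `W3_sandwichPNega_le` / `W3_sandwichNegaNoUnit` and (C1), (C3') (point, then the `x`-chart origin: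
  `ν_{(1,2)} ≥ 4` kills `xy`), `W3_box_exponents`.

NOT statements of the manuscript; OURS objects; elementary identities over `𝔽₂` ([folklore]). Host item
`--supports stmt-ResolutionOfSingularities-15522`.
-/

noncomputable section

set_option linter.dupNamespace false

namespace Summit.ResolutionOfSingularities.ResolutionOfSingularities.Theorems.Campaign

open Literature.AlgebraicGeometry.Resolution
open Literature.AlgebraicGeometry.Hironaka2017
open MvPolynomial

/-! ## Part D — witness W1 = `(y² + x w², 2)` (R01/R04/R08, tree `NegaWitness`): unit-free in every degree -/

section W1

/-- (C1) `g₁ ∈ 𝔪₀²`: `0 ∈ Sing(E₁)`, `E₁ = (g₁, 2)`; hence `℘(E₁, j) ⊆ 𝔪₀^j` (point blow-up permissible).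
[folklore] -/
theorem g1_mem_sq : Nega.g3 ∈ idealOfVars (Fin 3) (ZMod 2) ^ 2 := by
  have hX : ∀ i : Fin 3, (X i : MvPolynomial (Fin 3) (ZMod 2)) ∈ idealOfVars (Fin 3) (ZMod 2) :=
    fun i => Ideal.subset_span (Set.mem_range_self i)
  rw [pow_two, Nega.g3]
  refine Ideal.add_mem _ ?_ ?_
  · rw [pow_two]; exact Ideal.mul_mem_mul (hX 1) (hX 1)
  · rw [pow_two, ← mul_assoc]; exact Ideal.mul_mem_mul (Ideal.mul_mem_left _ _ (hX 2)) (hX 2)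

/-- (C2) `g₁ ∈ (y, w)²`: the `x`-axis `V(y, w)` lies in `Sing(E₁)` (order `2 = b` along it), so blowing it
up is permissible for `E₁`, hence for `((f), 2)` whenever `f ∈ ℘(E₁, 2)`: `℘(E₁,2) ⊆ (y,w)²` — the box
monomials `xy`, `xw` (exponents `(1,1,0)`, `(1,0,1)`: `j + l = 1 < 2`) have zero coefficient. [folklore] -/
theorem g1_mem_axis_sq : Nega.g3 ∈ (Ideal.span {(X 1 : MvPolynomial (Fin 3) (ZMod 2)), X 2}) ^ 2 := by
  have h1 : (X 1 : MvPolynomial (Fin 3) (ZMod 2)) ∈ Ideal.span {(X 1 : MvPolynomial (Fin 3) (ZMod 2)), X 2} :=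
    Ideal.subset_span (by simp)
  have h2 : (X 2 : MvPolynomial (Fin 3) (ZMod 2)) ∈ Ideal.span {(X 1 : MvPolynomial (Fin 3) (ZMod 2)), X 2} :=
    Ideal.subset_span (by simp)
  rw [pow_two, Nega.g3]
  refine Ideal.add_mem _ ?_ ?_
  · rw [pow_two]; exact Ideal.mul_mem_mul h1 h1
  · rw [pow_two, ← mul_assoc]; exact Ideal.mul_mem_mul (Ideal.mul_mem_left _ _ h2) h2

/-- (C3) First blow-up at `0`, `w`-chart `x = x'w, y = y'w, w = w`: `g₁ ↦ w² · (y'² + x' w)` — total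
transform `= I(D)^2 ·` (controlled transform `g₁' = y'² + x'w`). [folklore] -/
theorem g1_wChart :
    aeval ![X 0 * X 2, X 1 * X 2, X 2] Nega.g3
      = (X 2 ^ 2 * (X 1 ^ 2 + X 0 * X 2) : MvPolynomial (Fin 3) (ZMod 2)) := by
  simp only [Nega.g3, map_add, map_mul, map_pow, aeval_X]
  simp [Matrix.cons_val]
  ring

/-- (C3) The `w`-chart origin is a point of order `2` of `E₁' = (y'² + x'w, 2)`: blowing it up is
permissible for `E₁'`. For `f = Σ f_{ijl} x^i y^j w^l ∈ ℘(E₁,2)` the controlled transform is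
`Σ f_{ijl} x'^i y'^j w^{i+j+l−2}` (distinct monomials stay distinct), so permissibility for `((f'),2)` reads
`2i + 2j + l ≥ 4` on the support: the box monomial `yw` (`(0,1,1)`: `3 < 4`) has zero coefficient (and
so has `xw` again). [folklore] -/
theorem g1'_mem_sq : (X 1 ^ 2 + X 0 * X 2 : MvPolynomial (Fin 3) (ZMod 2)) ∈ idealOfVars (Fin 3) (ZMod 2) ^ 2 := by
  have hX : ∀ i : Fin 3, (X i : MvPolynomial (Fin 3) (ZMod 2)) ∈ idealOfVars (Fin 3) (ZMod 2) :=
    fun i => Ideal.subset_span (Set.mem_range_self i)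
  rw [pow_two]
  refine Ideal.add_mem _ ?_ (Ideal.mul_mem_mul (hX 0) (hX 2))
  rw [pow_two]; exact Ideal.mul_mem_mul (hX 1) (hX 1)

/-- Bookkeeping for (C2)/(C3) (`decide`): every box exponent `γ ∈ {0,1}³` of degree `≥ 2` violates (C2)
(`γ_y + γ_w ≥ 2`) or (C3) (`2γ_x + 2γ_y + γ_w ≥ 4`), except `γ = (1,1,1)` (the monomial `xyw`). [folklore] -/
theorem W1_box_exponents :
    ∀ γ : Fin 3 → Fin 2, 2 ≤ (γ 0 : ℕ) + γ 1 + γ 2 →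
      ((γ 1 : ℕ) + γ 2 < 2 ∨ 2 * (γ 0 : ℕ) + 2 * γ 1 + γ 2 < 4) ∨ γ = ![1, 1, 1] := by
  decide

/-- (C4) The LSB killing `xyw`: base-extend by `t`, blow up the smooth curve
`C = V(x − t², y, w) ⊂ Sing(E₁[t]) = V(y, w)` (permissible: `g₁ ∈ (y,w)² ⊆ I(C)²`, (C2)), `w`-chart
`x = u'w + t²`, `y = (z' + t) w` (i.e. `z' = (y + tw)/w` in characteristic `2`), `w = w`:
`g₁ ↦ w² · (z'² + u' w)`. [folklore] -/
theorem g1_movingChart :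
    aeval ![X 0 * X 2 + X 3 ^ 2, (X 1 + X 3) * X 2, X 2] Nega.g3
      = (X 2 ^ 2 * (X 1 ^ 2 + X 0 * X 2) : MvPolynomial (Fin 4) (ZMod 2)) := by
  have h2 : (2 : MvPolynomial (Fin 4) (ZMod 2)) = 0 := CharTwo.two_eq_zero
  simp only [Nega.g3, map_add, map_mul, map_pow, aeval_X]
  simp [Matrix.cons_val]
  linear_combination (X 1 * X 3 * X 2 ^ 2 + X 3 ^ 2 * X 2 ^ 2 : MvPolynomial (Fin 4) (ZMod 2)) * h2

/-- (C4) The line `L = V(u', z', w)` (the `t`-axis) lies in `Sing` of the transform `(z'² + u'w, 2)`: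
blowing it up is permissible, so `f' ∈ (u', z', w)²` for the controlled transform `f'` of every
`f ∈ ℘(E₁, 2)`. [folklore] -/
theorem g1_moving'_mem_sq :
    (X 1 ^ 2 + X 0 * X 2 : MvPolynomial (Fin 4) (ZMod 2))
      ∈ (Ideal.span {(X 0 : MvPolynomial (Fin 4) (ZMod 2)), X 1, X 2}) ^ 2 := by
  have h0 : (X 0 : MvPolynomial (Fin 4) (ZMod 2)) ∈ Ideal.span {(X 0 : MvPolynomial (Fin 4) (ZMod 2)), X 1, X 2} :=
    Ideal.subset_span (by simp)
  have h1 : (X 1 : MvPolynomial (Fin 4) (ZMod 2)) ∈ Ideal.span {(X 0 : MvPolynomial (Fin 4) (ZMod 2)), X 1, X 2} :=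
    Ideal.subset_span (by simp)
  have h2 : (X 2 : MvPolynomial (Fin 4) (ZMod 2)) ∈ Ideal.span {(X 0 : MvPolynomial (Fin 4) (ZMod 2)), X 1, X 2} :=
    Ideal.subset_span (by simp)
  rw [pow_two]
  refine Ideal.add_mem _ ?_ (Ideal.mul_mem_mul h0 h2)
  rw [pow_two]; exact Ideal.mul_mem_mul h1 h1

/-- (C4) The controlled transform of `xyw` under the moving-point chart is `(u'w + t²)(z' + t)`:
`xyw ↦ w² · (u'w + t²)(z' + t)`. [folklore] -/
theorem xyw_movingChart :
    aeval ![X 0 * X 2 + X 3 ^ 2, (X 1 + X 3) * X 2, X 2] (X 0 * X 1 * X 2 : MvPolynomial (Fin 3) (ZMod 2))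
      = (X 2 ^ 2 * ((X 0 * X 2 + X 3 ^ 2) * (X 1 + X 3)) : MvPolynomial (Fin 4) (ZMod 2)) := by
  simp only [map_mul, aeval_X]
  simp [Matrix.cons_val]
  ring

/-- (C4) `(u'w + t²)(z' + t) ∉ (u', z', w)` — it restricts to `t³` on `L` — so a fortiori
`∉ (u', z', w)²`: `xyw ∉ ℘(E₁, 2)`. Coefficientwise (prose step recorded in KILL-TEST-K1.2.md §3): modulo
`(u',z',w)²` the transform of `f = Σ f_{ijl} x^i y^j w^l ∈ (y,w)²` has `z'`-component `Σ_i f_{i11} t^{2i}`, so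
`f_{i11} = 0` for all `i`; in particular the `xyw`-coefficient of every `f ∈ ℘(E₁,2)` vanishes. [folklore] -/
theorem xyw_moving'_not_mem :
    ((X 0 * X 2 + X 3 ^ 2) * (X 1 + X 3) : MvPolynomial (Fin 4) (ZMod 2))
      ∉ Ideal.span {(X 0 : MvPolynomial (Fin 4) (ZMod 2)), X 1, X 2} := by
  intro h
  have hle : Ideal.span {(X 0 : MvPolynomial (Fin 4) (ZMod 2)), X 1, X 2}
      ≤ RingHom.ker (aeval ![(0 : MvPolynomial (Fin 4) (ZMod 2)), 0, 0, X 3]).toRingHom := by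
    refine Ideal.span_le.2 ?_
    intro f hf
    simp only [Set.mem_insert_iff, Set.mem_singleton_iff] at hf
    rcases hf with rfl | rfl | rfl <;> simp [RingHom.mem_ker, Matrix.cons_val]
  have h0 := hle h
  simp only [RingHom.mem_ker, AlgHom.toRingHom_eq_coe, RingHom.coe_coe, map_mul, map_add, map_pow,
    aeval_X] at h0
  simp [Matrix.cons_val] at h0

/-- **K1.2, witness W1 — ALIVE-type row (kernel part).** For every family `P` with `P 2 ⊆ 𝔪₀^{[2]} =
(x², y², w²)` (certified for `℘(E₁,2)` by (C1)–(C4) + `W1_box_exponents`) and `P(2d) ⊆ 𝔪₀^{2d}` for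
`d ≥ 2` (`0 ∈ Sing`), EVERY Frobenius-sandwich negative module `℘nega^sw(E₁,−a)`, `a ≥ 1` (level `e = 1`,
`m = 2`) lies in `𝔪₀`: no unit at `ξ = 0` in any degree, in contrast with the absolute modules
(`Nega.hasseDeriv_two_g : ∂_y^{(2)} g₁ = 1`, prior C1). NOT a statement of the manuscript. [folklore] -/
theorem W1_sandwichPNega_le (P : ℕ → Ideal (MvPolynomial (Fin 3) (ZMod 2)))
    (hP2 : P 2 ≤ Ideal.span (Set.range fun i : Fin 3 => (X i : MvPolynomial (Fin 3) (ZMod 2)) ^ 2))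
    (hP : ∀ d : ℕ, 2 ≤ d → P (d * 2) ≤ idealOfVars (Fin 3) (ZMod 2) ^ (d * 2)) (a : ℕ) :
    sandwichPNega 2 1 P 2 a ≤ idealOfVars (Fin 3) (ZMod 2) :=
  sandwichPNega_le_idealOfVars 2 1 P 2 a fun d hd _ => by
    rcases Nat.lt_or_ge d 2 with h | h
    · obtain rfl : d = 1 := by omega
      simpa using hP2
    · have h4 : idealOfVars (Fin 3) (ZMod 2) ^ (d * 2)
          ≤ idealOfVars (Fin 3) (ZMod 2) ^ (3 * (2 - 1) + 1) := Ideal.pow_le_pow_right (by omega)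
      exact (hP d h).trans (h4.trans (by simpa using pow_idealOfVars_le_frobPow (n := 3) (k := ZMod 2) 2))

/-- **K1.2, witness W1 — the typed `Prop` holds.** Under the same certified hypotheses the typed
`SandwichNegaNoUnit 2 1 P 2` (res-L1-type-o2, p461383) holds over `𝔽₂[x,y,w]`. [folklore] -/
theorem W1_sandwichNegaNoUnit (P : ℕ → Ideal (MvPolynomial (Fin 3) (ZMod 2)))
    (hP2 : P 2 ≤ Ideal.span (Set.range fun i : Fin 3 => (X i : MvPolynomial (Fin 3) (ZMod 2)) ^ 2))
    (hP : ∀ d : ℕ, 2 ≤ d → P (d * 2) ≤ idealOfVars (Fin 3) (ZMod 2) ^ (d * 2)) :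
    SandwichNegaNoUnit 2 1 P 2 := fun a _ h1 =>
  one_not_mem_idealOfVars (W1_sandwichPNega_le P hP2 hP a h1)

end W1

/-! ## Part E — witness W3 = `(y² + yx⁴ + yx² + x⁴, 2) ⊂ A²` (R05 #2): unit-free in every degree -/

section W3

/-- (C1) `g₃ ∈ 𝔪₀²`: `0 ∈ Sing(E₃)`, `E₃ = (g₃, 2)`. [folklore] -/
theorem g3_mem_sq :
    (X 1 ^ 2 + X 1 * X 0 ^ 4 + X 1 * X 0 ^ 2 + X 0 ^ 4 : MvPolynomial (Fin 2) (ZMod 2))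
      ∈ idealOfVars (Fin 2) (ZMod 2) ^ 2 := by
  have hX : ∀ i : Fin 2, (X i : MvPolynomial (Fin 2) (ZMod 2)) ∈ idealOfVars (Fin 2) (ZMod 2) :=
    fun i => Ideal.subset_span (Set.mem_range_self i)
  rw [pow_two]
  refine Ideal.add_mem _ (Ideal.add_mem _ (Ideal.add_mem _ ?_ ?_) ?_) ?_
  · rw [pow_two]; exact Ideal.mul_mem_mul (hX 1) (hX 1)
  · rw [show (X 1 * X 0 ^ 4 : MvPolynomial (Fin 2) (ZMod 2)) = (X 1 * X 0 ^ 3) * X 0 by ring]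
    exact Ideal.mul_mem_mul (Ideal.mul_mem_right _ _ (hX 1)) (hX 0)
  · rw [show (X 1 * X 0 ^ 2 : MvPolynomial (Fin 2) (ZMod 2)) = (X 1 * X 0) * X 0 by ring]
    exact Ideal.mul_mem_mul (Ideal.mul_mem_right _ _ (hX 1)) (hX 0)
  · rw [show (X 0 : MvPolynomial (Fin 2) (ZMod 2)) ^ 4 = X 0 ^ 3 * X 0 by ring]
    exact Ideal.mul_mem_mul (Ideal.pow_mem_of_mem _ (hX 0) 3 (by norm_num)) (hX 0)

/-- (C3') First blow-up at `0`, `x`-chart `x = x, y = x y'`: `g₃ ↦ x² · (y'² + x³y' + x y' + x²)`.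
[folklore] -/
theorem g3_xChart :
    aeval ![X 0, X 0 * X 1] (X 1 ^ 2 + X 1 * X 0 ^ 4 + X 1 * X 0 ^ 2 + X 0 ^ 4 : MvPolynomial (Fin 2) (ZMod 2))
      = (X 0 ^ 2 * (X 1 ^ 2 + X 0 ^ 3 * X 1 + X 0 * X 1 + X 0 ^ 2) : MvPolynomial (Fin 2) (ZMod 2)) := by
  simp only [map_add, map_mul, map_pow, aeval_X]
  simp
  ring

/-- (C3') The `x`-chart origin is a point of order `2` of `E₃' = (y'² + x³y' + xy' + x², 2)`: blowing it
up is permissible. For `f = Σ f_{ij} x^i y^j ∈ ℘(E₃,2)` the controlled transform is `Σ f_{ij} x^{i+j−2} y'^j`,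
so permissibility for `((f'),2)` reads `i + 2j ≥ 4` on the support (`ν_{(1,2)}(f) ≥ 4`): the only box
monomial of degree `2`, `xy` (`1 + 2 = 3 < 4`), has zero coefficient. [folklore] -/
theorem g3'_mem_sq :
    (X 1 ^ 2 + X 0 ^ 3 * X 1 + X 0 * X 1 + X 0 ^ 2 : MvPolynomial (Fin 2) (ZMod 2))
      ∈ idealOfVars (Fin 2) (ZMod 2) ^ 2 := by
  have hX : ∀ i : Fin 2, (X i : MvPolynomial (Fin 2) (ZMod 2)) ∈ idealOfVars (Fin 2) (ZMod 2) :=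
    fun i => Ideal.subset_span (Set.mem_range_self i)
  rw [pow_two]
  refine Ideal.add_mem _ (Ideal.add_mem _ (Ideal.add_mem _ ?_ ?_) (Ideal.mul_mem_mul (hX 0) (hX 1))) ?_
  · rw [pow_two]; exact Ideal.mul_mem_mul (hX 1) (hX 1)
  · rw [show (X 0 ^ 3 * X 1 : MvPolynomial (Fin 2) (ZMod 2)) = (X 0 ^ 3) * X 1 by ring]
    exact Ideal.mul_mem_mul (Ideal.pow_mem_of_mem _ (hX 0) 3 (by norm_num)) (hX 1)
  · rw [pow_two]; exact Ideal.mul_mem_mul (hX 0) (hX 0)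

/-- Bookkeeping for (C3') (`decide`): every box exponent `γ ∈ {0,1}²` of degree `≥ 2` (only `(1,1)`)
violates `γ_x + 2γ_y ≥ 4`. [folklore] -/
theorem W3_box_exponents :
    ∀ γ : Fin 2 → Fin 2, 2 ≤ (γ 0 : ℕ) + γ 1 → (γ 0 : ℕ) + 2 * γ 1 < 4 := by
  decide

/-- **K1.2, witness W3 — ALIVE-type row (kernel part).** For every family `P` with `P 2 ⊆ 𝔪₀^{[2]} =
(x², y²)` (certified for `℘(E₃,2)` by (C1), (C3') + `W3_box_exponents`) and `P(2d) ⊆ 𝔪₀^{2d}` for `d ≥ 2`,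
every Frobenius-sandwich negative module `℘nega^sw(E₃,−a)` (level `e = 1`, `m = 2`) lies in `𝔪₀`.
NOT a statement of the manuscript. [folklore] -/
theorem W3_sandwichPNega_le (P : ℕ → Ideal (MvPolynomial (Fin 2) (ZMod 2)))
    (hP2 : P 2 ≤ Ideal.span (Set.range fun i : Fin 2 => (X i : MvPolynomial (Fin 2) (ZMod 2)) ^ 2))
    (hP : ∀ d : ℕ, 2 ≤ d → P (d * 2) ≤ idealOfVars (Fin 2) (ZMod 2) ^ (d * 2)) (a : ℕ) :
    sandwichPNega 2 1 P 2 a ≤ idealOfVars (Fin 2) (ZMod 2) :=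
  sandwichPNega_le_idealOfVars 2 1 P 2 a fun d hd _ => by
    rcases Nat.lt_or_ge d 2 with h | h
    · obtain rfl : d = 1 := by omega
      simpa using hP2
    · have h3 : idealOfVars (Fin 2) (ZMod 2) ^ (d * 2)
          ≤ idealOfVars (Fin 2) (ZMod 2) ^ (2 * (2 - 1) + 1) := Ideal.pow_le_pow_right (by omega)
      exact (hP d h).trans (h3.trans (by simpa using pow_idealOfVars_le_frobPow (n := 2) (k := ZMod 2) 2))

/-- **K1.2, witness W3 — the typed `Prop` holds** (as for W1). [folklore] -/
theorem W3_sandwichNegaNoUnit (P : ℕ → Ideal (MvPolynomial (Fin 2) (ZMod 2)))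
    (hP2 : P 2 ≤ Ideal.span (Set.range fun i : Fin 2 => (X i : MvPolynomial (Fin 2) (ZMod 2)) ^ 2))
    (hP : ∀ d : ℕ, 2 ≤ d → P (d * 2) ≤ idealOfVars (Fin 2) (ZMod 2) ^ (d * 2)) :
    SandwichNegaNoUnit 2 1 P 2 := fun a _ h1 =>
  one_not_mem_idealOfVars (W3_sandwichPNega_le P hP2 hP a h1)

end W3

end Summit.ResolutionOfSingularities.ResolutionOfSingularities.Theorems.Campaign
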